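import Literature.MathematicalPhysics.QuantumFieldTheory.Balaban1983to89.T4ShellMeasure

/-!
# `T4Continuum.Spine.NE7c.LiveFactorGlobalCascade` — spine estimate NE7c (node U5b), road (δ): the own-level candidate
# sum (L2↓) of the global members IS member (δ-1)'s cascade count applied PER LEVEL — `Lit.T4ShellMeasure` §8 BY NAME
# (cell `pub-balaban-gaps`, track G2, seat ne8 gen 8; record `HOME/ne/NE7c.md` §15)

HONEST FRAMING.  Finite four-torus programme, rung (B)+1 only — NOT infinite volume, NOT a mass gap, NOT the Clay
problem, NOT summit progress, NOT a proof of NE7c (INSTANCE 0∕1, node O).  Nothing of [Bałaban 1983–89] is asserted;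
threshold randomisation is the cell's device ([folklore]); below: the positivity of the lower Lebesgue integral and the
pointwise cascade count of `Lit.T4ShellMeasure` §8, re-packaged.  No `def`, 0 sorry.  Spine PROVED 0∕9 — unchanged.

WHAT THIS FILE PINS.  The global members of road (δ) (`LiveFactorGlobalLevels.exists_global_level_assignment`, gen 7;
`LiveFactorGlobalCompact.exists_global_assignment_compact`, gen 8) take as hypothesis (L2↓): «inside the candidate grid,
with the other levels frozen, the `n j` candidate shell weights of level `j` of a comparison sum to `≤ V j ×` the
comparison's total weight».  The decision-tree READING (R) of `Lit.T4ShellMeasure` §8 delivers exactly this, level by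
level, by the machinery member (δ-1) already uses for ONE common factor: take as BOOKED the tests carrying a level-`j`
threshold (they are the ones whose thresholds move with the level-`j` candidate index `m`; every other test — of any
level, at any stage, with its threshold frozen — is candidate-independent given the older path and is absorbed into
the outcome maps `LiveStage.next`, or into the dead prefix `a₀`), whatever the INTERLEAVING of the stages; then at every
configuration the level-`j` shell hits summed over `m` number at most `2(∏_σ(ν_σ + 1) − 1)` over the stages `σ`
carrying level-`j` tests (`Lit.T4ShellMeasure.sum_hits₂_livePaths_le`), and integrating against the comparison's
threshold-free measure (`sum_toReal_lintegral_le_of_pointwise`) gives (L2↓) with `V j = 2(∏_σ(ν^{(j)}_σ + 1) − 1)` and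
`ZA K = μ_K(univ)` (`ownLevel_sum_le_of_cascade₂`; one-sided form `ownLevel_sum_le_of_cascade`).  `ownLevel_hyp_of_cascade`
states it in the letters of the global members' hypothesis `hA` (per comparison `K`, level `j`, frozen grid assignment
`c`).  CONSEQUENCE (census `HOME/ne/NE7c.md` §15): on the NE7c side the one-family END costs NO located reading beyond
member (δ-1)'s (R) + (W1) — the per-level stage data below is what node O owes for (δ-1) anyway, indexed by level.
NOT HERE: the decision tree of Bałaban's expansion (node O); the identification of the candidate shell weights with
integrated hit counts (hypothesis `hw`, as (δ-1)'s `hF`); NE7c NOT proved.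
-/

namespace Summit.QuantumFields.BalabanUV.T4Continuum.Spine.NE7c.LiveFactorGlobalCascade

open Finset MeasureTheory
open scoped ENNReal NNReal
open Literature.MathematicalPhysics.QuantumFieldTheory.Balaban1983to89
open Literature.MathematicalPhysics.QuantumFieldTheory.Balaban1983to89.T4ShellMeasure

/-- **(L2↓) FROM THE CASCADE COUNT, ONE-SIDED** (shells below the thresholds): per configuration `x` the stages
`σ < S` carrying level-`j` tests (`st x σ`, at most `ν σ` tests each given the older path, outcome maps absorbing every
frozen test), the dead prefix `a₀ x`; candidate weights `w m` dominated by the integrated level-`j` hit counts `N m`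
(themselves dominated pointwise by the hits along the realized paths).  THEN `Σ_{m<n} w m ≤ (∏_σ(ν_σ + 1) − 1)·μ(univ)`.
(`Lit.T4ShellMeasure.sum_le_cascade_of_hits` + `candidateTotals_le_of_pointwise` BY NAME.) [folklore] -/
theorem ownLevel_sum_le_of_cascade {X α τ : Type*} [MeasurableSpace X] [DecidableEq α] (μ : Measure X)
    [IsFiniteMeasure μ] (st : X → ℕ → LiveStage α τ) (a₀ : X → α) (ν : ℕ → ℕ)
    (hν : ∀ x σ a, ((st x σ).tests a).card ≤ ν σ) (S n : ℕ) (w : ℕ → ℝ) (N : ℕ → X → ℝ≥0∞)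
    (hN : ∀ x, ∀ m ∈ range n, N m x ≤ ((∑ σ ∈ range S, (st x σ).hits (livePaths (st x) (a₀ x) σ) m : ℕ) : ℝ≥0∞))
    (hw : ∀ m ∈ range n, w m ≤ (∫⁻ x, N m x ∂μ).toReal) :
    ∑ m ∈ range n, w m ≤ ((∏ σ ∈ range S, (ν σ + 1) - 1 : ℕ) : ℝ) * (μ Set.univ).toReal := by
  have hpt := sum_le_cascade_of_hits st a₀ ν hν S n N hN
  have h := candidateTotals_le_of_pointwise μ w N ((∏ σ ∈ range S, (ν σ + 1) - 1 : ℕ) : ℝ≥0)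
    (fun x => by simpa only [ENNReal.coe_natCast] using hpt x) hw
  simpa only [NNReal.coe_natCast] using h

/-- **(L2↓) FROM THE CASCADE COUNT, TWO-SIDED** (shells below AND above the candidate thresholds — small-field and
large-field slots, `T4IndicatorShell.shellBelow` ∕ `shellAbove`): the same with the hit counts `hits + hitsAbove` and the
constant `2(∏_σ(ν_σ + 1) − 1)` (`Lit.T4ShellMeasure.sum_hits₂_livePaths_le` BY NAME). [folklore] -/
theorem ownLevel_sum_le_of_cascade₂ {X α τ : Type*} [MeasurableSpace X] [DecidableEq α] (μ : Measure X)
    [IsFiniteMeasure μ] (st : X → ℕ → LiveStage α τ) (a₀ : X → α) (ν : ℕ → ℕ)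
    (hν : ∀ x σ a, ((st x σ).tests a).card ≤ ν σ) (S n : ℕ) (w : ℕ → ℝ) (N : ℕ → X → ℝ≥0∞)
    (hN : ∀ x, ∀ m ∈ range n, N m x ≤ ((∑ σ ∈ range S, ((st x σ).hits (livePaths (st x) (a₀ x) σ) m
        + (st x σ).hitsAbove (livePaths (st x) (a₀ x) σ) m) : ℕ) : ℝ≥0∞))
    (hw : ∀ m ∈ range n, w m ≤ (∫⁻ x, N m x ∂μ).toReal) :
    ∑ m ∈ range n, w m ≤ ((2 * ∏ σ ∈ range S, (ν σ + 1) - 2 : ℕ) : ℝ) * (μ Set.univ).toReal := by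
  have hpt : ∀ x, ∑ m ∈ range n, N m x ≤ ((2 * ∏ σ ∈ range S, (ν σ + 1) - 2 : ℕ) : ℝ≥0∞) := by
    intro x
    have h := sum_hits₂_livePaths_le (st x) (a₀ x) n ν (hν x) S
    calc ∑ m ∈ range n, N m x
        ≤ ∑ m ∈ range n, ((∑ σ ∈ range S, ((st x σ).hits (livePaths (st x) (a₀ x) σ) m
            + (st x σ).hitsAbove (livePaths (st x) (a₀ x) σ) m) : ℕ) : ℝ≥0∞) := sum_le_sum (hN x)
      _ = ((∑ σ ∈ range S, ∑ m ∈ range n, ((st x σ).hits (livePaths (st x) (a₀ x) σ) m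
            + (st x σ).hitsAbove (livePaths (st x) (a₀ x) σ) m) : ℕ) : ℝ≥0∞) := by
          rw [← Nat.cast_sum, sum_comm]
      _ ≤ ((2 * ∏ σ ∈ range S, (ν σ + 1) - 2 : ℕ) : ℝ≥0∞) := by
          exact_mod_cast (by omega : ∑ σ ∈ range S, ∑ m ∈ range n, ((st x σ).hits (livePaths (st x) (a₀ x) σ) m
            + (st x σ).hitsAbove (livePaths (st x) (a₀ x) σ) m) ≤ 2 * ∏ σ ∈ range S, (ν σ + 1) - 2)
  have h := candidateTotals_le_of_pointwise μ w N ((2 * ∏ σ ∈ range S, (ν σ + 1) - 2 : ℕ) : ℝ≥0)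
    (fun x => by simpa only [ENNReal.coe_natCast] using hpt x) hw
  simpa only [NNReal.coe_natCast] using h

/-- **(L2↓) IN THE LETTERS OF THE GLOBAL MEMBERS' HYPOTHESIS `hA`.**  Per comparison `K` a finite threshold-free measure
`μ K` on its configuration space; per comparison, level `j` and frozen grid assignment `c` the stage data of the level-`j`
tests (`st K j c`, dead prefixes `a₀ K j c`, at most `ν j σ` level-`j` tests at its `σ`-th stage, `S j` such stages —
(W1)-type counts, uniform in `K` and `c`) and integrands `N K j c m` dominating the candidate weights
`wA K j (update c j m)` and dominated pointwise by the two-sided level-`j` hits.  THEN the hypothesis `hA` of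
`LiveFactorGlobalLevels.exists_global_level_assignment` ∕ `LiveFactorGlobalCompact.exists_global_assignment_compact` holds
with `V j = 2·∏_{σ<S j}(ν j σ + 1) − 2` and `ZA K = μ K (univ)`. [folklore] -/
theorem ownLevel_hyp_of_cascade {α τ : Type*} [DecidableEq α] {X : ℕ → Type*} [∀ K, MeasurableSpace (X K)]
    (μ : (K : ℕ) → Measure (X K)) [∀ K, IsFiniteMeasure (μ K)] (n : ℕ → ℕ)
    (wA : ℕ → ℕ → (ℕ → ℕ) → ℝ) (S : ℕ → ℕ) (ν : ℕ → ℕ → ℕ)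
    (st : (K j : ℕ) → (ℕ → ℕ) → X K → ℕ → LiveStage α τ) (a₀ : (K j : ℕ) → (ℕ → ℕ) → X K → α)
    (hν : ∀ K j c x σ a, ((st K j c x σ).tests a).card ≤ ν j σ)
    (N : (K j : ℕ) → (ℕ → ℕ) → ℕ → X K → ℝ≥0∞)
    (hN : ∀ K j c, (∀ l, c l < n l) → ∀ x, ∀ m ∈ range (n j), N K j c m x ≤
      ((∑ σ ∈ range (S j), ((st K j c x σ).hits (livePaths (st K j c x) (a₀ K j c x) σ) m
        + (st K j c x σ).hitsAbove (livePaths (st K j c x) (a₀ K j c x) σ) m) : ℕ) : ℝ≥0∞))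
    (hw : ∀ K j c, (∀ l, c l < n l) → ∀ m ∈ range (n j),
      wA K j (Function.update c j m) ≤ (∫⁻ x, N K j c m x ∂μ K).toReal) :
    ∀ K j (c : ℕ → ℕ), (∀ l, c l < n l) →
      ∑ m ∈ range (n j), wA K j (Function.update c j m)
        ≤ ((2 * ∏ σ ∈ range (S j), (ν j σ + 1) - 2 : ℕ) : ℝ) * (μ K Set.univ).toReal :=
  fun K j c hc => ownLevel_sum_le_of_cascade₂ (μ K) (st K j c) (a₀ K j c) (ν j) (hν K j c) (S j) (n j)
    (fun m => wA K j (Function.update c j m)) (N K j c) (hN K j c hc) (hw K j c hc)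

end Summit.QuantumFields.BalabanUV.T4Continuum.Spine.NE7c.LiveFactorGlobalCascade
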